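import Mathlib
import Summits.NavierStokesRegularity.NavierStokesRegularity.Theorems.TaoLadderRungTwoBreakOneShiftWindowFastChecks
import Summits.NavierStokesRegularity.NavierStokesRegularity.Theorems.TaoLadderRungTwoBreakOneShiftWindowStepEndI
import Summits.NavierStokesRegularity.NavierStokesRegularity.Theorems.TaoLadderRungTwoBreakOneShiftWindowGridCD
import HarnessLib

/-!
# The one-shift window system, LXIII: TABLE-HOISTED FORMS OF THE END-BOX LINK BOOLEANS — `CentreStepD.endBoxOnF /
# endBoxOnIF` (the end box from GIVEN jet tables), `GridCD.plinkOKA s` and `GridCD.zlinkOKA TI Zc`, provably EQUAL to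
# `plinkOK s` resp. to the per-coordinate `zlink` hypothesis of parts LIII/LIX
# (cell harvest/h2-tao-ladder, seat p2; rung1/KERNEL-CHEAP-REPLAY-SPEC.md §11; support for K1(1) = `NoSurvivingDSSOne`,
# stmt-NavierStokesRegularity-20205)

WHY (emitter sizing, p2 g15): the landed `RoughStepD.endBoxROn X tD c` recomputes the jet tables of `X` AND of the
a-priori box `S` inside every coordinate `c` (≈ 2 · n · (K² · nnz) interval operations per step ≈ 2–3 h at n = 304,
K = 16) although the tables depend on the step only. As in part LX, the hoisted Booleans compute the tables once and are
EQUAL to the landed ones (`plinkOKA_eq`, `zlinkOKA_iff`).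

MODEL lattice ODEs only; nothing here is a statement about the Navier–Stokes equations; no item is closed; no instance
is evaluated here.
-/

-- the sub-problem namespace repeats the summit name by design (D-0017)
set_option linter.dupNamespace false

namespace Summit.NavierStokesRegularity.NavierStokesRegularity.Theorems

namespace DSSOneShift

open Summit.NavierStokesRegularity.NavierStokesRegularity.Theorems.TaylorModelCert
open Summit.NavierStokesRegularity.NavierStokesRegularity.Theorems.CertificateGlueOn

namespace CentreStepD

variable (d : CentreStepD)

/-- The end box at an interval time from GIVEN jet tables `LX` (of the start sub-box) and `LS` (of the a-priori box). [cite: Moore1979, §8.1 eq. (8.10); NedialkovJacksonPryce2001, §3] -/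
def endBoxOnIF (LX LS : Array (Array IntervalD)) (TI : IntervalD) (c : ℕ) : IntervalD :=
  IntervalD.addR d.prec
    (IntervalD.rangeSumR d.prec (fun j => IntervalD.mulR d.prec (IntervalD.powR d.prec TI j)
      (IntervalD.aget (IntervalD.lget LX j) c)) d.K)
    (IntervalD.mulR d.prec (IntervalD.powR d.prec TI d.K) (IntervalD.aget (IntervalD.lget LS d.K) c))

/-- At the step's own tables, `endBoxOnIF` is `endBoxOnI`. [folklore] -/
theorem endBoxOnIF_eq (X : Array IntervalD) : d.endBoxOnIF (d.jets X) (d.jets d.S) = d.endBoxOnI X := by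
  funext TI c; rfl

/-- At the step's own tables and a point time, `endBoxOnIF` is `endBoxOn`. [folklore] -/
theorem endBoxOnIF_ofDyad_eq (X : Array IntervalD) (tD : Dyad) :
    d.endBoxOnIF (d.jets X) (d.jets d.S) (IntervalD.ofDyad tD) = d.endBoxOn X tD := by
  funext c; rfl

end CentreStepD

namespace GridCD

variable (g : GridCD)

/-- **The point-box link test of step `s` with hoisted jet tables.** [cite: KapelaZgliczynski2009, §4 Lemma 4.1; Moore1979, §8.1 eq. (8.10)] -/
def plinkOKA (s : ℕ) : Bool :=
  let d := (g.step s).toRoughStepD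
  let LX := d.centre.jets (g.P s)
  let LS := d.centre.jets d.centre.S
  (List.range g.n).all fun c =>
    IntervalD.subset
      ⟨(d.centre.endBoxOnIF LX LS (IntervalD.ofDyad (g.h s)) c).lo.sub (RoughStepD.dget d.Zh c),
        (d.centre.endBoxOnIF LX LS (IntervalD.ofDyad (g.h s)) c).hi.add (RoughStepD.dget d.Zh c)⟩
      (IntervalD.aget (g.P (s + 1)) c)

/-- **The hoisted point-box link test IS the landed one.** [folklore] -/
theorem plinkOKA_eq (s : ℕ) : g.plinkOKA s = g.plinkOK s := by
  unfold plinkOKA plinkOK RoughStepD.endBoxROn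
  simp only [CentreStepD.endBoxOnIF_ofDyad_eq]

/-- **The K3 link test with hoisted jet tables**: `endBoxROnI (P S) TI ⊆ Zc` coordinatewise. [cite: KapelaZgliczynski2009, §4 Lemma 4.1; Moore1979, §8.1 eq. (8.10)] -/
def zlinkOKA (TI : IntervalD) (Zc : Array IntervalD) : Bool :=
  let d := (g.step g.S).toRoughStepD
  let LX := d.centre.jets (g.P g.S)
  let LS := d.centre.jets d.centre.S
  (List.range g.n).all fun c =>
    IntervalD.subset
      ⟨(d.centre.endBoxOnIF LX LS TI c).lo.sub (RoughStepD.dget d.Zh c),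
        (d.centre.endBoxOnIF LX LS TI c).hi.add (RoughStepD.dget d.Zh c)⟩
      (IntervalD.aget Zc c)

/-- **The hoisted K3 link test gives the per-coordinate hypothesis `hzlink` of parts LIII/LIX.** [folklore] -/
theorem zlink_of_zlinkOKA {TI : IntervalD} {Zc : Array IntervalD} (h : g.zlinkOKA TI Zc = true) :
    ∀ c < g.n, IntervalD.subset ((g.step g.S).toRoughStepD.endBoxROnI (g.P g.S) TI c) (IntervalD.aget Zc c) = true := by
  unfold zlinkOKA at h
  simp only [CentreStepD.endBoxOnIF_eq, List.all_eq_true, List.mem_range] at h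
  intro c hc
  exact h c hc

end GridCD

end DSSOneShift

end Summit.NavierStokesRegularity.NavierStokesRegularity.Theorems
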